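import Summits.BirchSwinnertonDyer.BirchSwinnertonDyer.Theorems.PrintCf2RubinValueTwoTwistedKatoKummerSystem
import Summits.BirchSwinnertonDyer.BirchSwinnertonDyer.Theorems.PrintCf2RubinValueTwoRelCoresTowerBookkeeping
import HarnessLib

/-!
# F0b (zeta pins of `JohnsonLeungKings2011.TwistedIwasawaData`), FILE 4: the ZETA FAMILY `(y_{𝔞,n,k})` on the `ℤ_p²`-layers —
# `y_{𝔞,n,k} = cor_{K(p^s𝔣)/K̃_n}(Kummer_k(ζ_{p^s𝔣}) ⊗ t_p(θ))`, independent of `s`, compatible in `n` (corestriction) and `k` (reduction)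

Cell `bsd-print-cf2`, WIDTH seat `bsd-line-cf2-p1-w5` g10 (prover-bsd-line-cf2-p1-w5-g10-0); construction F0b of route C
(`PrintCf2RubinValueTwo`), plan `HOME/bsd-line-cf2-p1-w5/F0B-ASSEMBLY-PLAN-w5g9.md` steps 4–5; `--supports` the deciding child
stmt-BirchSwinnertonDyer-24721 (helper, Theses-free). THEOREMS ONLY (no definition, no named fact, no instance, no `sorry`). Prints enter ONLY as
displayed hypotheses ((E) `Kato2004.sec155_exists_katoUnitRep`, (O1) `DeShalit1987.prop25_i_normRelation` + `prop24_i_mem_rayClassField`).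
HONEST FRAMING: bookkeeping towards the EXISTENCE of ty2's pinned datum; nothing here closes the crux; no summit statement is proved by this
seat; BSD is not proved by any of this.

WHAT. **`exists_zetaFamily`**: for `K` imaginary quadratic, `𝔣 ≠ 0`, `θ` trivial on `Gal(K̄/K(𝔣))` and ANY pair `(κ₁, κ₂)` of `ℤ_p`-extensions,
from (E)/(O1) there are the system `(s₀, u, β, c)` of FILE 3 AND a family `y a n k ∈ H¹(G_S(K̃_n), μ_{p^k} ⊗ θ)` which is a COMPATIBLE FAMILY
(ty2's `IsCompatibleFamily … 1`, i.e. an element of the pinned `H¹ = lim←_{n,k}`) and equals `relCores_{Gal(K̄/K̃_n) ← Gal(K̄/K(p^s𝔣))} (c a s k)` for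
EVERY `s ≥ s₀`, `s ≥ k + 2` with `K̃_n ⊆ K(p^s𝔣)` — JLK §5.2 "`_𝔞ζ(χ) := lim←_n _𝔞ζ_{K_n}(χ)`", Burungale–Flach's "`_𝔞ζ_{K_n}(χ) =
tr_{K(𝔣_χ p^{r+n})/K_n}(_𝔞z ⊗ t(χ))`" (proof of Lemma 7), levelwise. The `s`-independence / (P1) / (P2) are -w2 g17's `RelCoresTower` lemmas fed
with FILE 3's norm and reduction laws; the levels `K̃_n ⊆ K(p^s𝔣)` exist by -w2 g17's `exists_katoLevelSubgroup_le_pairLayerSubgroup` (totally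
complex `K`).

References: J. Johnson-Leung, G. Kings (2011) Def. 3.5, Def. 4.2 (94), §5.2; A. Burungale, M. Flach (2024) §3.2, §4.1 Lemma 7; K. Kato,
Astérisque 295 §8.2, §15.5.
-/

noncomputable section

open scoped Classical

-- the summit namespace `Summit.BirchSwinnertonDyer.BirchSwinnertonDyer` repeats the problem name by design (D-0017)
set_option linter.dupNamespace false
set_option autoImplicit false

open scoped NumberField
open Field IsDedekindDomain
open Literature.NumberTheory.NumberFields (rayClassField)
open Literature.NumberTheory.GaloisRepresentations Literature.NumberTheory.GaloisRepresentations.DiscreteGaloisModule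
open Literature.NumberTheory.EllipticCurves (IsImaginaryQuadratic ZpExtension)
open Literature.NumberTheory.ComplexMultiplication.EllipticUnits
open Literature.NumberTheory.ComplexMultiplication.EllipticUnits.JohnsonLeungKings2011
open Summit.BirchSwinnertonDyer.BirchSwinnertonDyer.Theorems.PrintCf2.RelCoresTower

namespace Summit.BirchSwinnertonDyer.BirchSwinnertonDyer.Theorems.PrintCf2.TwistedZeta

variable {K : Type} [Field K] [NumberField K] (p : ℕ) [Fact p.Prime] (θ : absoluteGaloisGroup K →ₜ* ℤ_[p]ˣ)
  (𝔣 : Ideal (𝓞 K)) (κ₁ κ₂ : ZpExtension K p)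

/-- **THE ZETA FAMILY ON THE `ℤ_p²`-LAYERS.** For `K` imaginary quadratic, `𝔣 ≠ 0`, `θ` trivial on `Gal(K̄/K(𝔣))`, any pair `(κ₁, κ₂)`, from
(E) and (O1): the system `(s₀, u, β, c)` of FILE 3 together with `y a n k ∈ H¹(G_S(K̃_n), μ_{p^k} ⊗ θ)` such that (i) each `y a` is a compatible
family in `(n, k)` — `cor_{K̃_{n+1}/K̃_n} y_{n+1,k} = y_{n,k}`, `red y_{n,k+1} = y_{n,k}` — and (ii) `y a n k = relCores_{Gal(K̄/K̃_n) ← Gal(K̄/K(p^s𝔣))}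
(c a s k)` for every `s ≥ s₀`, `s ≥ k+2` with `Gal(K̄/K(p^s𝔣)) ≤ Gal(K̄/K̃_n)`: "`_𝔞ζ_{K̃_n}(χ,𝔣) = cor_{K(p^s𝔣)/K̃_n}(Kummer_k(ζ_{p^s𝔣}) ⊗ t_p(χ))`
for every large `s`" (pin (Z1) levelwise), `_𝔞ζ(χ) = lim←_n _𝔞ζ_{K̃_n}(χ)` (§5.2).
[cite: JohnsonLeungKings2011, Def. 3.5, Def. 4.2 (94), §5.2 (arXiv p0010:L72–80, p0012:L94, p0014:L80–90)] [cite: BurungaleFlach2024, §3.2 and §4.1 Lemma 7 with proof (arXiv p0013:L30–36, p0017:L50–68)] [cite: Kato2004Asterisque, §8.2 (p. 180), §15.5 (p. 253)] -/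
theorem exists_zetaFamily (hE : Kato2004.sec155_exists_katoUnitRep) (h25 : DeShalit1987.prop25_i_normRelation)
    (h24i : DeShalit1987.prop24_i_mem_rayClassField) (hK : IsImaginaryQuadratic K) (ι : K →+* ℂ) (h𝔣 : 𝔣 ≠ ⊥)
    (hθ𝔣 : ∀ σ ∈ absGaloisFixingSubgroup (rayClassField K 𝔣), θ σ = 1) :
    ∃ (s₀ : ℕ) (u : AuxIdeals p 𝔣 → ℕ → (AlgebraicClosure K)ˣ) (β : AuxIdeals p 𝔣 → ℕ → ℕ → (AlgebraicClosure K)ˣ)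
      (c : ∀ (a : AuxIdeals p 𝔣) (s k : ℕ), levelCoh p (suppPF p 𝔣) θ (katoLevelSubgroup p 𝔣 s) k 1)
      (y : AuxIdeals p 𝔣 → ∀ n k : ℕ, layerCoh p κ₁ κ₂ θ 𝔣 n k 1),
      1 ≤ s₀ ∧
      (∀ a s, s₀ ≤ s → IsKatoUnitRep p ι 𝔣 s a.1 (u a s)) ∧
      (∀ a s k, β a s k ^ (p ^ k) = (u a s)⁻¹) ∧
      (∀ a s k, IsTwistedKummerClass p θ (suppPF p 𝔣) (katoLevelSubgroup p 𝔣 s) k (β a s k) (c a s k)) ∧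
      (∀ a, IsCompatibleFamily p κ₁ κ₂ θ 𝔣 1 (y a)) ∧
      (∀ a n k s, s₀ ≤ s → k + 2 ≤ s → ∀ hle : katoLevelSubgroup p 𝔣 s ≤ JohnsonLeungKings2011.pairLayerSubgroup κ₁ κ₂ n,
        y a n k = relCores p (suppPF p 𝔣) θ hle (JohnsonLeungKings2011.isOpen_pairLayerSubgroup κ₁ κ₂ n)
          (isOpen_absGaloisFixingSubgroup K (katoLayer p 𝔣 s)) k 1 (c a s k)) := by
  haveI : NumberField.IsTotallyComplex K := hK.2
  obtain ⟨s₀, u, β, c, hs₀, hu, -, hβ, hc, hred, hnorm⟩ := exists_katoKummerSystem p θ 𝔣 hE h25 h24i hK ι h𝔣 hθ𝔣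
  -- the norm law in the shape of the `RelCoresTower` bookkeeping, threshold `max s₀ (k + 2)`
  have hnc : ∀ (a : AuxIdeals p 𝔣) (k s : ℕ), max s₀ (k + 2) ≤ s →
      relCores p (suppPF p 𝔣) θ (katoLevelSubgroup_antitone p 𝔣 h𝔣 (Nat.le_succ s)) (isOpen_katoLevelSubgroup p 𝔣 s)
        (isOpen_katoLevelSubgroup p 𝔣 (s + 1)) k 1 (c a (s + 1) k) = c a s k :=
    fun a k s hs ↦ hnorm a s k (le_of_max_le_left hs) (le_of_max_le_right hs)
  -- independence of the auxiliary level
  have key : ∀ (a : AuxIdeals p 𝔣) (n k s s' : ℕ), max s₀ (k + 2) ≤ s → max s₀ (k + 2) ≤ s' →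
      ∀ (hle : katoLevelSubgroup p 𝔣 s ≤ JohnsonLeungKings2011.pairLayerSubgroup κ₁ κ₂ n) (hle' : katoLevelSubgroup p 𝔣 s' ≤ JohnsonLeungKings2011.pairLayerSubgroup κ₁ κ₂ n),
      relCores p (suppPF p 𝔣) θ hle (JohnsonLeungKings2011.isOpen_pairLayerSubgroup κ₁ κ₂ n) (isOpen_katoLevelSubgroup p 𝔣 s) k 1 (c a s k) =
        relCores p (suppPF p 𝔣) θ hle' (JohnsonLeungKings2011.isOpen_pairLayerSubgroup κ₁ κ₂ n) (isOpen_katoLevelSubgroup p 𝔣 s') k 1 (c a s' k) := by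
    intro a n k s s' hs hs' hle hle'
    rcases le_total s s' with h | h
    · exact (relCores_pairLayer_eq_of_norm_compatible p θ 𝔣 κ₁ κ₂ h𝔣 (fun t ↦ c a t k) (hnc a k) n hs h hle).symm
    · exact relCores_pairLayer_eq_of_norm_compatible p θ 𝔣 κ₁ κ₂ h𝔣 (fun t ↦ c a t k) (hnc a k) n hs' h hle'
  -- levels fine enough for each layer and depth
  have HT : ∀ n k : ℕ, ∃ s, max s₀ (k + 2) ≤ s ∧ katoLevelSubgroup p 𝔣 s ≤ JohnsonLeungKings2011.pairLayerSubgroup κ₁ κ₂ n := by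
    intro n k
    obtain ⟨s₁, hs₁⟩ := exists_katoLevelSubgroup_le_pairLayerSubgroup 𝔣 h𝔣 κ₁ κ₂ n
    exact ⟨max (max s₀ (k + 2)) s₁, le_max_left _ _, (katoLevelSubgroup_antitone p 𝔣 h𝔣 (le_max_right _ _)).trans hs₁⟩
  choose T hT using HT
  refine ⟨s₀, u, β, c, fun a n k ↦ relCores p (suppPF p 𝔣) θ (hT n k).2 (JohnsonLeungKings2011.isOpen_pairLayerSubgroup κ₁ κ₂ n)
    (isOpen_katoLevelSubgroup p 𝔣 (T n k)) k 1 (c a (T n k) k), hs₀, hu, hβ, hc, fun a ↦ ⟨fun n k ↦ ?_, fun n k ↦ ?_⟩,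
    fun a n k s hs hks hle ↦ ?_⟩
  · -- (P1) `cor_{K̃_{n+1}/K̃_n} y_{n+1,k} = y_{n,k}`
    exact (layerCores_relCores_pairLayer p θ 𝔣 κ₁ κ₂ n (hT (n + 1) k).2 (c a (T (n + 1) k) k)).trans
      (key a n k (T (n + 1) k) (T n k) (hT (n + 1) k).1 (hT n k).1
        ((hT (n + 1) k).2.trans (JohnsonLeungKings2011.pairLayerSubgroup_antitone κ₁ κ₂ (Nat.le_succ n))) (hT n k).2)
  · -- (P2) `red y_{n,k+1} = y_{n,k}`
    have hm : max s₀ (k + 2) ≤ T n (k + 1) := (max_le_max le_rfl (by omega)).trans (hT n (k + 1)).1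
    exact (layerRed_relCores_pairLayer p θ 𝔣 κ₁ κ₂ n (hT n (k + 1)).2 (c a (T n (k + 1)) (k + 1)) (c a (T n (k + 1)) k)
      (hred a (T n (k + 1)) k)).trans (key a n k (T n (k + 1)) (T n k) hm (hT n k).1 (hT n (k + 1)).2 (hT n k).2)
  · -- the component at every large level
    exact (key a n k s (T n k) (max_le hs hks) (hT n k).1 hle (hT n k).2).symm

end Summit.BirchSwinnertonDyer.BirchSwinnertonDyer.Theorems.PrintCf2.TwistedZeta

end
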